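import Summits.BirchSwinnertonDyer.BirchSwinnertonDyer.Theorems.RamifiedHeegnerPairTwistUnitInert
import HarnessLib

/-!
# U₁ at the two-SPLIT-carrier Gss2 classes (the Shimura rows), TU|inert — part Q: `235422t1`, `237636l1`

Continuation of `…Theorems.RamifiedHeegnerPairTwistUnitInert` (seat `bsd-trib-w-rhp` g14; the generic lemmas, the two doors
`leafRankOneUpper_three_of_twoCarriers_of_sqrtField` / `leafRankOneUpper_three_of_twoInert_twoOutside_of_sqrtField` and the full framing are there): per rank-one curve
`subGss_three_<label>` (Addv ∧ SubGss at `3` in the kernel), `Δ_eq_/c₄_eq_/krausList_<label>`, Kraus minimality of `V = E^{(-3)}_min` and of the twist model `Wd`, and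
`u1_at_<label> : … → MissingUpperBoundAt W 3` by rhp-p2 g10's two-carrier instrument p657297 `LeafShimuraInert.leafRankOneUpper_three_of_twoCarriers_of_twistUnit`
(resp. p654714 `…_of_shimuraInertDatum_of_twistUnit` on the two-outside rows) with the six printed facts `hGZK hmod hnf hJL hCO hHK` as hypotheses, the split / no-split / Tate
certificates, `hothers`, `hshape` and the field congruences IN THE KERNEL, and `hN hr Dt hc` + the twist `L`-value + `#Ш(Wd)_an` DISPLAYED (+ `bsd3_at_<label>`, lower half
free).  **HONEST FRAMING: theorems only; per-curve certificates under DISPLAYED inputs (conductor, analytic rank, `3 ∤ c(Dt)`, the twist `L`-value, `#Ш(Wd)_an`) and the six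
printed facts of the road as hypotheses; nothing is booked, no item is closed; U₁ (26022) / TU|inert / the Shimura-curve Gross–Zagier–Kolyvagin inputs stay research-level and
OPEN class-wide; BSD is NOT proved for any curve by this file.**
[cite: JetchevSkinnerWan2017, §7.4.2 (p. 31), Thm. 4.4.1 (p. 19)] [cite: PastenShimura2024, Prop. 6.13, Lemma 6.16, Lemma 6.18 (pp. 23–24)]
[cite: PapikianRabinoff2016, Cor. 3.5] [cite: SilvermanAEC2009, VII.5 Prop. 5.1] [cite: SilvermanATAEC1994, IV.9.4] [cite: Tate1975, §7] [cite: Kraus1989, Prop. 1]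
[cite: Marcus2018, Ch. 3 Thm. 25] [cite: Miller2011LMS, Def. 1.1] [cite: Cremona2006, Table 1]
-/

set_option linter.dupNamespace false
set_option autoImplicit false

noncomputable section

open scoped Classical NumberField

open WeierstrassCurve NumberField IsDedekindDomain IsDedekindDomain.HeightOneSpectrum Rat.HeightOneSpectrum Field Literature Literature.NumberTheory.DiophantineGeometry
  Literature.NumberTheory.EllipticCurves Literature.NumberTheory.EllipticCurves.ModularForms Literature.NumberTheory.EllipticCurves.Rank1Residual
  Literature.NumberTheory.EllipticCurves.Rank1Residual.Typed Literature.NumberTheory.Automorphic Literature.NumberTheory.EllipticCurves.Rank1Residual.X11RankOneCertificates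
  Literature.NumberTheory.EllipticCurves.KrizLi2019 Literature.NumberTheory.GaloisRepresentations Literature.NumberTheory.QuadraticFields Literature.NumberTheory.QuadraticFields.Quadratic
  Summit.BirchSwinnertonDyer.BirchSwinnertonDyer.Rank1Residual Summit.BirchSwinnertonDyer.BirchSwinnertonDyer.Rank1Residual.IntModel
  Summit.BirchSwinnertonDyer.BirchSwinnertonDyer.Rank2Observatory.Tam Summit.BirchSwinnertonDyer.Rank1Residual Summit.BirchSwinnertonDyer.Rank1Residual.Additive
  Summit.BirchSwinnertonDyer.Rank1Residual.X11b Summit.BirchSwinnertonDyer.Rank1Residual.X11b.Three Summit.BirchSwinnertonDyer.Rank1Residual.X9 Summit.BirchSwinnertonDyer.Rank1Residual.GaloisImage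
  Summit.BirchSwinnertonDyer.Rank1Residual.Supersingular Summit.BirchSwinnertonDyer.BirchSwinnertonDyer.Theses.RamifiedHeegnerPair Summit.BirchSwinnertonDyer.BirchSwinnertonDyer.Theorems
  Summit.BirchSwinnertonDyer.BirchSwinnertonDyer.Theorems.SchneiderFree Summit.BirchSwinnertonDyer.BirchSwinnertonDyer.Theorems.RamifiedPairUpperBound
  Summit.BirchSwinnertonDyer.BirchSwinnertonDyer.Theorems.RamifiedHeegnerPairStepLIntrinsic Summit.BirchSwinnertonDyer.BirchSwinnertonDyer.Theorems.AdditiveBranchIMCGordTwoRankOne.HeegnerKolyvagin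
  Summit.BirchSwinnertonDyer.BirchSwinnertonDyer.Theorems.RamifiedHeegnerPairTwistUnitIntrinsic Summit.BirchSwinnertonDyer.BirchSwinnertonDyer.Theorems.RamifiedHeegnerPairTwistUnitAdditive

namespace Summit.BirchSwinnertonDyer.BirchSwinnertonDyer.Theorems.RamifiedHeegnerPairTwistUnitInert

/-! ## §31 `235422t1` = `[1, -1, 1, -47612, 4011967]`, `N = 235422 = 2·3^2·11·29·41` (`2`: I12, `c = 12`, split, `3`: I₀*, `c = 1`, `11`: I3, `c = 3`, split, `29`: I1, `c = 1`, split, `41`: I1, `c = 1`, non-split); carriers `S = {2, 11}` (split, `3 ∣ ord Δ`), (DEG) by Papikian–Rabinoff at `q₂ = 11` (odd, `≡ 2 (mod 3)`);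
`r_an = 1`, `#E(ℚ)_tors = 1`, `∏ c_ℓ = 36`, `#Ш(E)_an = 1` (Cremona/LMFDB, displayed where used); class `235422t` of size 1.
`V = E^{(-3)}_min = [1, -1, 0, -5290, -146828]` (`#Ṽ(𝔽₃) = 7`).  JSW field `K = ℚ(√-59)` (`59` prime; `2`, `11` inert, every other `ℓ ∣ N` split): the least such `D` with a twist unit
(kit j317417: `L(E^{(-59)},1)/Ω = 8 ≠ 0`, root no. `+1`, `Wd = E^{(-59)}_min = [1, -1, 0, -165736284, -821487780784]`, `N(Wd) = 819503982`, `∏c = 8`, `T = 1`, `#Ш(Wd)_an = (L/Ω)T²/∏c = 1` exactly). -/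

/-- `V = [1, -1, 0, -5290, -146828]` (the minimal model of `235422t1^{(-3)}`, conductor `26158`): `Δ ≠ 0` in the kernel. [cite: Cremona2006, Table 1 (Cremona label 235422t1)] -/
theorem isElliptic_sV235422t1 : (⟨1, -1, 0, -5290, -146828⟩ : WeierstrassCurve ℚ).IsElliptic :=
  isElliptic_of_discOf_ne_zero 1 (-1) 0 (-5290) (-146828) (by decide +kernel)

/-- `V` is globally minimal: `|Δ| = 2^12·11^3·29·41` kernel-checked, Kraus' criterion prime by prime. [cite: Kraus1989, Prop. 1 and Prop. 2]
[cite: SilvermanAEC2009, VII.1 Remark 1.1] [cite: Cremona2006, Table 1 (Cremona label 235422t1)] -/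
theorem isGloballyMinimal_sV235422t1 : (⟨1, -1, 0, -5290, -146828⟩ : WeierstrassCurve ℚ).IsGloballyMinimal :=
  isGloballyMinimal_of_krausCriterion₃_factored 1 (-1) 0 (-5290) (-146828)
    [(2, 12), (11, 3), (29, 1), (41, 1)] (by decide +kernel)
    (by intro qe hqe; simp only [List.mem_cons, List.not_mem_nil, or_false] at hqe
        rcases hqe with rfl | rfl | rfl | rfl <;> norm_num)
    (by set_option synthInstance.maxSize 2000 in decide +kernel)

/-- `Wd = [1, -1, 0, -165736284, -821487780784]` (the minimal model of the twist `235422t1^{(-59)}`, conductor `819503982`): `Δ ≠ 0` in the kernel. [cite: Cremona2006, Table 1 (Cremona label 235422t1)] -/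
theorem isElliptic_sWd235422t1 : (⟨1, -1, 0, -165736284, -821487780784⟩ : WeierstrassCurve ℚ).IsElliptic :=
  isElliptic_of_discOf_ne_zero 1 (-1) 0 (-165736284) (-821487780784) (by decide +kernel)

/-- `Wd` is globally minimal: `|Δ| = 2^12·3^6·11^3·29·41·59^6` kernel-checked, Kraus' criterion prime by prime. [cite: Kraus1989, Prop. 1 and Prop. 2]
[cite: SilvermanAEC2009, VII.1 Remark 1.1] [cite: Cremona2006, Table 1 (Cremona label 235422t1)] -/
theorem isGloballyMinimal_sWd235422t1 : (⟨1, -1, 0, -165736284, -821487780784⟩ : WeierstrassCurve ℚ).IsGloballyMinimal :=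
  isGloballyMinimal_of_krausCriterion₃_factored 1 (-1) 0 (-165736284) (-821487780784)
    [(2, 12), (3, 6), (11, 3), (29, 1), (41, 1), (59, 6)] (by decide +kernel)
    (by intro qe hqe; simp only [List.mem_cons, List.not_mem_nil, or_false] at hqe
        rcases hqe with rfl | rfl | rfl | rfl | rfl | rfl <;> norm_num)
    (by set_option synthInstance.maxSize 2000 in decide +kernel)

/-- **`235422t1` is ADDITIVE at `3` and on the cell (G) ∧ ss, IN THE KERNEL**: `3 ∣ Δ`, `3 ∣ c₄`; `C • V^{(-3)} = E` (`[u, r, s, t] = [1, -1, 1/2, 1/2]`) with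
`V` globally minimal, `3 ∤ Δ(V)`, `#Ṽ(𝔽₃) = 7` (`a₃(V) = -3`, supersingular), whence `TypeG`, `SubGord`, `SubGss` at `3` (g13's block, unchanged).
[cite: SilvermanAEC2009, VII.5 Prop. 5.1 (a), (c)] [cite: Delbourgo1998, §1.5 (G)] [cite: Cremona2006, Table 1 (Cremona label 235422t1)] -/
theorem subGss_three_235422t1 {W : WeierstrassCurve ℚ} [W.IsElliptic] [W.IsGloballyMinimal] (hWeq : W = (⟨1, -1, 1, -47612, 4011967⟩ : WeierstrassCurve ℚ)) :
    Addv W 3 ∧ SubGss W 3 := by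
  subst hWeq
  haveI := isElliptic_sV235422t1
  haveI := isGloballyMinimal_sV235422t1
  have hIW : integralModelInt (⟨1, -1, 1, -47612, 4011967⟩ : WeierstrassCurve ℚ) = (⟨1, -1, 1, -47612, 4011967⟩ : WeierstrassCurve ℤ) :=
    integralModelInt_eq_of_map_eq _ (map_mk_int 1 (-1) 1 (-47612) 4011967)
  have hadd : Addv (⟨1, -1, 1, -47612, 4011967⟩ : WeierstrassCurve ℚ) 3 := Additive.addv_of_intModel hIW 3 (by decide +kernel) (by decide +kernel)
  have hIV : integralModelInt (⟨1, -1, 0, -5290, -146828⟩ : WeierstrassCurve ℚ) = (⟨1, -1, 0, -5290, -146828⟩ : WeierstrassCurve ℤ) :=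
    integralModelInt_eq_of_map_eq _ (map_mk_int 1 (-1) 0 (-5290) (-146828))
  have hcV : Nat.card ((((⟨1, -1, 0, -5290, -146828⟩ : WeierstrassCurve ℤ)).map (Int.castRingHom (ZMod 3))).toAffine.Point) = 7 := by
    have h := natCard_point_eq_countPoints 1 (-1) 0 (-5290) (-146828) 3 (by norm_num) (by decide +kernel)
    have h' : countPoints [1, -1, 0, -5290, -146828] 3 = 7 := countPoints_eq_of_fast (by decide +kernel)
    exact_mod_cast h.trans h'
  have hgood : GoodSS (⟨1, -1, 0, -5290, -146828⟩ : WeierstrassCurve ℚ) 3 := Supersingular.goodSS_of_intModel 3 hIV (by decide +kernel) hcV (by decide)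
  have hVW : (⟨1, (-1 : ℚ), ((1:ℚ)/2), ((1:ℚ)/2)⟩ : VariableChange ℚ) • (⟨1, -1, 0, -5290, -146828⟩ : WeierstrassCurve ℚ).quadraticTwist (-3) =
      (⟨1, -1, 1, -47612, 4011967⟩ : WeierstrassCurve ℚ) := by
    ext <;> simp [WeierstrassCurve.variableChange_a₁, WeierstrassCurve.variableChange_a₂,
      WeierstrassCurve.variableChange_a₃, WeierstrassCurve.variableChange_a₄, WeierstrassCurve.variableChange_a₆,
      WeierstrassCurve.quadraticTwist, WeierstrassCurve.b₂, WeierstrassCurve.b₄, WeierstrassCurve.b₆] <;> norm_num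
  obtain ⟨C, hC⟩ := exists_variableChange_quadraticTwist_symm (⟨1, -1, 1, -47612, 4011967⟩ : WeierstrassCurve ℚ)
    (⟨1, -1, 0, -5290, -146828⟩ : WeierstrassCurve ℚ) (d := (-3 : ℚ)) (by norm_num) ⟨_, hVW⟩
  have hC' : C • (⟨1, -1, 1, -47612, 4011967⟩ : WeierstrassCurve ℚ).quadraticTwist ((-1 : ℚ) ^ ((3 : ℕ) / 2) * (3 : ℕ)) =
      (⟨1, -1, 0, -5290, -146828⟩ : WeierstrassCurve ℚ) := by
    rw [O5.pstar_three]; exact hC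
  have hG : TypeG (⟨1, -1, 1, -47612, 4011967⟩ : WeierstrassCurve ℚ) 3 := (typeG_three_iff_good_twist _ hadd _ C hC').mpr hgood.1
  exact ⟨hadd, (O5.subGss_three_iff_subGord_and_goodSS_twist _ hadd _ C hC).mpr
    ⟨subGord_three_of_typeG_of_addv _ hG hadd, hgood⟩⟩

/-- `Δ(E₀) = -4725495853056 = -2^12·3^6·11^3·29·41` on the integer equation of `235422t1`. [cite: Cremona2006, Table 1 (Cremona label 235422t1)] -/
theorem Δ_eq_235422t1 : (⟨1, -1, 1, -47612, 4011967⟩ : WeierstrassCurve ℤ).Δ = -4725495853056 := by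
  norm_num [WeierstrassCurve.Δ, WeierstrassCurve.b₂, WeierstrassCurve.b₄, WeierstrassCurve.b₆, WeierstrassCurve.b₈]

/-- `c₄(E₀) = 2285361` on the integer equation of `235422t1`. [cite: Cremona2006, Table 1 (Cremona label 235422t1)] -/
theorem c₄_eq_235422t1 : (⟨1, -1, 1, -47612, 4011967⟩ : WeierstrassCurve ℤ).c₄ = 2285361 := by
  norm_num [WeierstrassCurve.c₄, WeierstrassCurve.b₂, WeierstrassCurve.b₄]

/-- The Kraus list of `235422t1` consists of primes and multiplies to `|Δ(E₀)|`, IN THE KERNEL: a prime dividing `Δ_min` is one of `[2, 3, 11, 29, 41]`. [cite: Cremona2006, Table 1 (Cremona label 235422t1)] -/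
theorem krausList_235422t1 : (∀ qe ∈ ([(2, 12), (3, 6), (11, 3), (29, 1), (41, 1)] : List (ℕ × ℕ)), qe.1.Prime) ∧
    (([(2, 12), (3, 6), (11, 3), (29, 1), (41, 1)] : List (ℕ × ℕ)).map fun qe => qe.1 ^ qe.2).prod = (-4725495853056 : ℤ).natAbs :=
  ⟨by decide +kernel, by decide +kernel⟩

/-- **U₁ AT `235422t1` BY THE INERT-CARRIER (Shimura-curve) ROAD, TU|inert** — `MissingUpperBoundAt W 3` at `W = E` from rhp-p2 g10's instrument
p657297 (two carriers, Papikian–Rabinoff (DEG)) through the §0 door `leafRankOneUpper_three_of_twoCarriers_of_sqrtField` of part one.  PRINTED: `hGZK hmod hnf hJL hCO hHK`.  KERNEL: `Addv ∧ SubGss` at `3`;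
`2`, `11` split (nodal roots `0`, `0`); every prime of `Δ_min` enumerated (`krausList_235422t1`) for `hothers` and `hshape` (`c = 1` off `Δ_min`, Kodaira–Néron at the
multiplicative primes, Tate certificates at the additive primes `[3]`); the congruences making `2`, `11` inert and the other `ℓ ∣ N` split in `ℚ(√-59)`; the twist
identity `Cd • E^{(-59)} = Wd`, `Cd = [1, -15, 1/2, 0]`, with `Wd` Kraus-minimal.  DISPLAYED: `hN`, `hr`, `Dt`/`hc` (`3 ∤ c(Dt)`), `hLt` (`L(E^{(-59)},1) ≠ 0`), `hqd`/`hvd`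
(`#Ш(Wd)_an = 1`).  NO ¬CM / S2 / Σ / L₀.  Per curve; U₁ (26022) stays OPEN class-wide; `BSDp W 3` follows by `bsdp_three_of_upper_of_shaAn_unit`; BSD is NOT proved by this.
[cite: JetchevSkinnerWan2017, §7.4.2 (p. 31)] [cite: PastenShimura2024, Prop. 6.13, Lemma 6.18] [cite: SilvermanAEC2009, VII.5 Prop. 5.1] [cite: Cremona2006, Table 1 (Cremona label 235422t1)] -/
theorem u1_at_235422t1
    (hGZK : rank_eq_analyticRank_of_analyticRank_le_one) (hmod : hasEntireLFunction_rat)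
    (hnf : exists_isNewformOf) (hJL : nonempty_shimuraParametrizationData)
    (hCO : PastenShimura2024_componentOrders)
    (hHK : shimuraCurve_heegnerPoint_grossZagier_kolyvagin)
    {W : WeierstrassCurve ℚ} [W.IsElliptic] [W.IsGloballyMinimal] (hWeq : W = (⟨1, -1, 1, -47612, 4011967⟩ : WeierstrassCurve ℚ))
    (hN : W.conductorNorm ℤ = 235422) [NeZero (W.conductorNorm ℤ)] (hr : W.analyticRank = 1)
    (Dt : ModularParametrizationData W (W.conductorNorm ℤ)) (hc : ¬ (3 : ℤ) ∣ Dt.c)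
    (hLt : (W.quadraticTwist (((-59 : ℤ) : ℚ))).entireLFunction 1 ≠ 0)
    {qd : ℚ} (hqd : haveI := isElliptic_sWd235422t1; shaAn (⟨1, -1, 0, -165736284, -821487780784⟩ : WeierstrassCurve ℚ) = (qd : ℂ))
    (hvd : padicValRat 3 qd ≤ 0) :
    MissingUpperBoundAt W 3 := by
  subst hWeq
  haveI := isElliptic_sWd235422t1; haveI := isGloballyMinimal_sWd235422t1
  have hI : integralModelInt (⟨1, -1, 1, -47612, 4011967⟩ : WeierstrassCurve ℚ) = (⟨1, -1, 1, -47612, 4011967⟩ : WeierstrassCurve ℤ) :=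
    integralModelInt_eq_of_map_eq _ (map_mk_int 1 (-1) 1 (-47612) 4011967)
  have hGS := subGss_three_235422t1 (W := (⟨1, -1, 1, -47612, 4011967⟩ : WeierstrassCurve ℚ)) rfl
  have hs₁ : haveI : Fact (Nat.Prime 2) := ⟨by norm_num⟩; (⟨1, -1, 1, -47612, 4011967⟩ : WeierstrassCurve ℚ).HasSplitMultiplicativeReductionAtPrime 2 := by
    refine IntModel.hasSplitMultiplicativeReductionAtPrime_of_intModel_of_root hI 2 (by rw [Δ_eq_235422t1]; norm_num) (by rw [c₄_eq_235422t1]; norm_num) ⟨0, ?_⟩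
    simp only [WeierstrassCurve.c₄, WeierstrassCurve.b₂, WeierstrassCurve.b₄, WeierstrassCurve.b₆]; push_cast; decide
  have hs₂ : haveI : Fact (Nat.Prime 11) := ⟨by norm_num⟩; (⟨1, -1, 1, -47612, 4011967⟩ : WeierstrassCurve ℚ).HasSplitMultiplicativeReductionAtPrime 11 := by
    refine IntModel.hasSplitMultiplicativeReductionAtPrime_of_intModel_of_root hI 11 (by rw [Δ_eq_235422t1]; norm_num) (by rw [c₄_eq_235422t1]; norm_num) ⟨0, ?_⟩
    simp only [WeierstrassCurve.c₄, WeierstrassCurve.b₂, WeierstrassCurve.b₄, WeierstrassCurve.b₆]; push_cast; decide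
  haveI : Fact ((-59 : ℤ) < 0) := ⟨by norm_num⟩; haveI : Fact (Nat.Prime 2) := ⟨by norm_num⟩; haveI : Fact (Nat.Prime 11) := ⟨by norm_num⟩
  have hothers : ∀ (ℓ : ℕ) [Fact ℓ.Prime], ℓ ≠ 2 → ℓ ≠ 11 → (⟨1, -1, 1, -47612, 4011967⟩ : WeierstrassCurve ℚ).HasSplitMultiplicativeReductionAtPrime ℓ →
      ¬ 3 ∣ padicValInt ℓ (⟨1, -1, 1, -47612, 4011967⟩ : WeierstrassCurve ℚ).minimalDiscriminantInt := by
    intro ℓ hℓF hne₁ hne₂ hs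
    have hd := dvd_minimalDiscriminantInt_of_mult _ ℓ hs.hasMultiplicativeReductionAtPrime
    rw [IntModel.minimalDiscriminantInt_eq hI, Δ_eq_235422t1] at hd
    have hmem := mem_of_prime_dvd_of_prodPow_eq _ krausList_235422t1 hℓF.out hd
    simp only [List.map_cons, List.map_nil, List.mem_cons, List.not_mem_nil, or_false] at hmem
    rcases hmem with rfl | rfl | rfl | rfl | rfl
    · exact absurd rfl hne₁
    · exact absurd hs.hasMultiplicativeReductionAtPrime (X9.PrintCert.not_hasMultiplicativeReductionAtPrime_of_dvd_of_dvd hI 3 (by rw [Δ_eq_235422t1]; norm_num) (by rw [c₄_eq_235422t1]; norm_num))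
    · exact absurd rfl hne₂
    · rw [IntModel.minimalDiscriminantInt_eq hI, Δ_eq_235422t1, IntModel.padicValInt_eq_of_dvd_of_not_dvd 29 (e := 1) (by norm_num) (by norm_num)]
      decide
    · rw [IntModel.minimalDiscriminantInt_eq hI, Δ_eq_235422t1, IntModel.padicValInt_eq_of_dvd_of_not_dvd 41 (e := 1) (by norm_num) (by norm_num)]
      decide
  have hshape : ∀ (q : ℕ) [Fact q.Prime], 3 ∣ ((⟨1, -1, 1, -47612, 4011967⟩ : WeierstrassCurve ℚ).baseChange ℚ_[q]).localTamagawaNumber ℤ_[q] →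
      (⟨1, -1, 1, -47612, 4011967⟩ : WeierstrassCurve ℚ).HasSplitMultiplicativeReductionAtPrime q := by
    intro q hqF h3
    by_cases hd : (q : ℤ) ∣ minimalDiscriminantInt (⟨1, -1, 1, -47612, 4011967⟩ : WeierstrassCurve ℚ)
    swap
    · exact absurd h3 (not_three_dvd_localTamagawaNumber_of_not_dvd _ q hd)
    rw [IntModel.minimalDiscriminantInt_eq hI, Δ_eq_235422t1] at hd
    have hmem := mem_of_prime_dvd_of_prodPow_eq _ krausList_235422t1 hqF.out hd
    simp only [List.map_cons, List.map_nil, List.mem_cons, List.not_mem_nil, or_false] at hmem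
    rcases hmem with rfl | rfl | rfl | rfl | rfl
    · exact hs₁
    · have hc3 : ((⟨1, -1, 1, -47612, 4011967⟩ : WeierstrassCurve ℚ).baseChange ℚ_[3]).localTamagawaNumber ℤ_[3] = 1 := -- additive `3` (I0*): Tate certificate
        (IntModelTam.localTamagawaNumber_padic_eq_of_intModel_of_tamZ hI 3 (F := ⟨3, 9, 1, 1, 8, 6, 0, 0⟩) rfl (by decide +kernel)).trans (by decide)
      rw [hc3] at h3; exact absurd h3 (by decide)
    · exact hs₂
    · exact (Koly.split_and_three_dvd_of_mult_of_three_dvd_localTamagawaNumber _ 29 (IntModel.hasMultiplicativeReductionAtPrime_of_intModel hI 29 (by rw [Δ_eq_235422t1]; norm_num) (by rw [c₄_eq_235422t1]; norm_num)) h3).1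
    · exact (Koly.split_and_three_dvd_of_mult_of_three_dvd_localTamagawaNumber _ 41 (IntModel.hasMultiplicativeReductionAtPrime_of_intModel hI 41 (by rw [Δ_eq_235422t1]; norm_num) (by rw [c₄_eq_235422t1]; norm_num)) h3).1
  have hjac : ∀ ℓ : ℕ, ℓ.Prime → ℓ ∣ (⟨1, -1, 1, -47612, 4011967⟩ : WeierstrassCurve ℚ).conductorNorm ℤ → ℓ ≠ 2 → ℓ ≠ 11 → ℓ ≠ 2 →
      jacobiSym (-59) ℓ = 1 := by
    intro ℓ hℓ hℓN hne₁ hne₂ hℓ2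
    rw [hN] at hℓN
    have hmem : ℓ ∈ Nat.primeFactors 235422 := Nat.mem_primeFactors.mpr ⟨hℓ, hℓN, by norm_num⟩
    rw [show Nat.primeFactors 235422 = {2, 3, 11, 29, 41} by decide +kernel] at hmem
    simp only [Finset.mem_insert, Finset.mem_singleton] at hmem
    rcases hmem with rfl | rfl | rfl | rfl | rfl
    · exact absurd rfl hne₁
    · norm_num [jacobiSym.mod_left]
    · exact absurd rfl hne₂
    · norm_num [jacobiSym.mod_left]
    · norm_num [jacobiSym.mod_left]
  have hWd : (⟨1, (-15 : ℚ), ((1:ℚ)/2), (0 : ℚ)⟩ : VariableChange ℚ) • (⟨1, -1, 1, -47612, 4011967⟩ : WeierstrassCurve ℚ).quadraticTwist (((-59 : ℤ) : ℚ)) =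
      (⟨1, -1, 0, -165736284, -821487780784⟩ : WeierstrassCurve ℚ) := by
    push_cast; ext <;> simp [WeierstrassCurve.variableChange_a₁, WeierstrassCurve.variableChange_a₂,
      WeierstrassCurve.variableChange_a₃, WeierstrassCurve.variableChange_a₄, WeierstrassCurve.variableChange_a₆,
      WeierstrassCurve.quadraticTwist, WeierstrassCurve.b₂, WeierstrassCurve.b₄, WeierstrassCurve.b₆] <;> norm_num
  exact leafRankOneUpper_three_of_twoCarriers_of_sqrtField hGZK hmod hnf hJL hCO hHK _ hGS.1 hGS.2 hr rfl Dt hc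
    (q₁ := 2) (q₂ := 11) (by decide) hs₁ hs₂ hothers (by decide) (by decide) hshape
    (-59) (by norm_num)
    (by rw [show (-59 : ℤ).natAbs = 59 by rfl, Nat.squarefree_iff_nodup_primeFactorsList (by norm_num)]; simp)
    (Or.inl ⟨rfl, by norm_num⟩) (by norm_num) (by norm_num [jacobiSym.mod_left]) (by norm_num) hjac
    (fun _ h ↦ absurd rfl h) hLt _ _ hWd hqd hvd

/-! ## §32 `237636l1` = `[0, 0, 0, -468513, 123432741]`, `N = 237636 = 2^2·3^2·7·23·41` (`2`: IV, `c = 1`, `3`: I₀*, `c = 4`, `7`: I3, `c = 3`, split, `23`: I1, `c = 1`, non-split, `41`: I3, `c = 3`, split); carriers `S = {7, 41}` (split, `3 ∣ ord Δ`), (DEG) by Papikian–Rabinoff at `q₂ = 41` (odd, `≡ 2 (mod 3)`);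
`r_an = 1`, `#E(ℚ)_tors = 1`, `∏ c_ℓ = 36`, `#Ш(E)_an = 1` (Cremona/LMFDB, displayed where used); class `237636l` of size 1.
`V = E^{(-3)}_min = [0, 0, 0, -52057, -4571583]` (`#Ṽ(𝔽₃) = 4`).  JSW field `K = ℚ(√-191)` (`191` prime; `7`, `41` inert, every other `ℓ ∣ N` split): the least such `D` with a twist unit
(kit j317417: `L(E^{(-191)},1)/Ω = 64 ≠ 0`, root no. `+1`, `Wd = E^{(-191)}_min = [0, 0, 0, -17091822753, -860063416464411]`, `N(Wd) = 8669198916`, `∏c = 16`, `T = 1`, `#Ш(Wd)_an = (L/Ω)T²/∏c = 4` exactly). -/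

/-- `V = [0, 0, 0, -52057, -4571583]` (the minimal model of `237636l1^{(-3)}`, conductor `26404`): `Δ ≠ 0` in the kernel. [cite: Cremona2006, Table 1 (Cremona label 237636l1)] -/
theorem isElliptic_sV237636l1 : (⟨0, 0, 0, -52057, -4571583⟩ : WeierstrassCurve ℚ).IsElliptic :=
  isElliptic_of_discOf_ne_zero 0 0 0 (-52057) (-4571583) (by decide +kernel)

/-- `V` is globally minimal: `|Δ| = 2^4·7^3·23·41^3` kernel-checked, Kraus' criterion prime by prime. [cite: Kraus1989, Prop. 1 and Prop. 2]
[cite: SilvermanAEC2009, VII.1 Remark 1.1] [cite: Cremona2006, Table 1 (Cremona label 237636l1)] -/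
theorem isGloballyMinimal_sV237636l1 : (⟨0, 0, 0, -52057, -4571583⟩ : WeierstrassCurve ℚ).IsGloballyMinimal :=
  isGloballyMinimal_of_krausCriterion₃_factored 0 0 0 (-52057) (-4571583)
    [(2, 4), (7, 3), (23, 1), (41, 3)] (by decide +kernel)
    (by intro qe hqe; simp only [List.mem_cons, List.not_mem_nil, or_false] at hqe
        rcases hqe with rfl | rfl | rfl | rfl <;> norm_num)
    (by set_option synthInstance.maxSize 2000 in decide +kernel)

/-- `Wd = [0, 0, 0, -17091822753, -860063416464411]` (the minimal model of the twist `237636l1^{(-191)}`, conductor `8669198916`): `Δ ≠ 0` in the kernel. [cite: Cremona2006, Table 1 (Cremona label 237636l1)] -/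
theorem isElliptic_sWd237636l1 : (⟨0, 0, 0, -17091822753, -860063416464411⟩ : WeierstrassCurve ℚ).IsElliptic :=
  isElliptic_of_discOf_ne_zero 0 0 0 (-17091822753) (-860063416464411) (by decide +kernel)

/-- `Wd` is globally minimal: `|Δ| = 2^4·3^6·7^3·23·41^3·191^6` kernel-checked, Kraus' criterion prime by prime. [cite: Kraus1989, Prop. 1 and Prop. 2]
[cite: SilvermanAEC2009, VII.1 Remark 1.1] [cite: Cremona2006, Table 1 (Cremona label 237636l1)] -/
theorem isGloballyMinimal_sWd237636l1 : (⟨0, 0, 0, -17091822753, -860063416464411⟩ : WeierstrassCurve ℚ).IsGloballyMinimal :=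
  isGloballyMinimal_of_krausCriterion₃_factored 0 0 0 (-17091822753) (-860063416464411)
    [(2, 4), (3, 6), (7, 3), (23, 1), (41, 3), (191, 6)] (by decide +kernel)
    (by intro qe hqe; simp only [List.mem_cons, List.not_mem_nil, or_false] at hqe
        rcases hqe with rfl | rfl | rfl | rfl | rfl | rfl <;> norm_num)
    (by set_option synthInstance.maxSize 2000 in decide +kernel)

/-- **`237636l1` is ADDITIVE at `3` and on the cell (G) ∧ ss, IN THE KERNEL**: `3 ∣ Δ`, `3 ∣ c₄`; `C • V^{(-3)} = E` (`[u, r, s, t] = [1, 0, 0, 0]`) with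
`V` globally minimal, `3 ∤ Δ(V)`, `#Ṽ(𝔽₃) = 4` (`a₃(V) = 0`, supersingular), whence `TypeG`, `SubGord`, `SubGss` at `3` (g13's block, unchanged).
[cite: SilvermanAEC2009, VII.5 Prop. 5.1 (a), (c)] [cite: Delbourgo1998, §1.5 (G)] [cite: Cremona2006, Table 1 (Cremona label 237636l1)] -/
theorem subGss_three_237636l1 {W : WeierstrassCurve ℚ} [W.IsElliptic] [W.IsGloballyMinimal] (hWeq : W = (⟨0, 0, 0, -468513, 123432741⟩ : WeierstrassCurve ℚ)) :
    Addv W 3 ∧ SubGss W 3 := by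
  subst hWeq
  haveI := isElliptic_sV237636l1
  haveI := isGloballyMinimal_sV237636l1
  have hIW : integralModelInt (⟨0, 0, 0, -468513, 123432741⟩ : WeierstrassCurve ℚ) = (⟨0, 0, 0, -468513, 123432741⟩ : WeierstrassCurve ℤ) :=
    integralModelInt_eq_of_map_eq _ (map_mk_int 0 0 0 (-468513) 123432741)
  have hadd : Addv (⟨0, 0, 0, -468513, 123432741⟩ : WeierstrassCurve ℚ) 3 := Additive.addv_of_intModel hIW 3 (by decide +kernel) (by decide +kernel)
  have hIV : integralModelInt (⟨0, 0, 0, -52057, -4571583⟩ : WeierstrassCurve ℚ) = (⟨0, 0, 0, -52057, -4571583⟩ : WeierstrassCurve ℤ) :=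
    integralModelInt_eq_of_map_eq _ (map_mk_int 0 0 0 (-52057) (-4571583))
  have hcV : Nat.card ((((⟨0, 0, 0, -52057, -4571583⟩ : WeierstrassCurve ℤ)).map (Int.castRingHom (ZMod 3))).toAffine.Point) = 4 := by
    have h := natCard_point_eq_countPoints 0 0 0 (-52057) (-4571583) 3 (by norm_num) (by decide +kernel)
    have h' : countPoints [0, 0, 0, -52057, -4571583] 3 = 4 := countPoints_eq_of_fast (by decide +kernel)
    exact_mod_cast h.trans h'
  have hgood : GoodSS (⟨0, 0, 0, -52057, -4571583⟩ : WeierstrassCurve ℚ) 3 := Supersingular.goodSS_of_intModel 3 hIV (by decide +kernel) hcV (by decide)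
  have hVW : (⟨1, (0 : ℚ), (0 : ℚ), (0 : ℚ)⟩ : VariableChange ℚ) • (⟨0, 0, 0, -52057, -4571583⟩ : WeierstrassCurve ℚ).quadraticTwist (-3) =
      (⟨0, 0, 0, -468513, 123432741⟩ : WeierstrassCurve ℚ) := by
    ext <;> simp [WeierstrassCurve.variableChange_a₁, WeierstrassCurve.variableChange_a₂,
      WeierstrassCurve.variableChange_a₃, WeierstrassCurve.variableChange_a₄, WeierstrassCurve.variableChange_a₆,
      WeierstrassCurve.quadraticTwist, WeierstrassCurve.b₂, WeierstrassCurve.b₄, WeierstrassCurve.b₆] <;> norm_num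
  obtain ⟨C, hC⟩ := exists_variableChange_quadraticTwist_symm (⟨0, 0, 0, -468513, 123432741⟩ : WeierstrassCurve ℚ)
    (⟨0, 0, 0, -52057, -4571583⟩ : WeierstrassCurve ℚ) (d := (-3 : ℚ)) (by norm_num) ⟨_, hVW⟩
  have hC' : C • (⟨0, 0, 0, -468513, 123432741⟩ : WeierstrassCurve ℚ).quadraticTwist ((-1 : ℚ) ^ ((3 : ℕ) / 2) * (3 : ℕ)) =
      (⟨0, 0, 0, -52057, -4571583⟩ : WeierstrassCurve ℚ) := by
    rw [O5.pstar_three]; exact hC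
  have hG : TypeG (⟨0, 0, 0, -468513, 123432741⟩ : WeierstrassCurve ℚ) 3 := (typeG_three_iff_good_twist _ hadd _ C hC').mpr hgood.1
  exact ⟨hadd, (O5.subGss_three_iff_subGord_and_goodSS_twist _ hadd _ C hC).mpr
    ⟨subGord_three_of_typeG_of_addv _ hG hadd, hgood⟩⟩

/-- `Δ(E₀) = 6341924057616 = 2^4·3^6·7^3·23·41^3` on the integer equation of `237636l1`. [cite: Cremona2006, Table 1 (Cremona label 237636l1)] -/
theorem Δ_eq_237636l1 : (⟨0, 0, 0, -468513, 123432741⟩ : WeierstrassCurve ℤ).Δ = 6341924057616 := by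
  norm_num [WeierstrassCurve.Δ, WeierstrassCurve.b₂, WeierstrassCurve.b₄, WeierstrassCurve.b₆, WeierstrassCurve.b₈]

/-- `c₄(E₀) = 22488624` on the integer equation of `237636l1`. [cite: Cremona2006, Table 1 (Cremona label 237636l1)] -/
theorem c₄_eq_237636l1 : (⟨0, 0, 0, -468513, 123432741⟩ : WeierstrassCurve ℤ).c₄ = 22488624 := by
  norm_num [WeierstrassCurve.c₄, WeierstrassCurve.b₂, WeierstrassCurve.b₄]

/-- The Kraus list of `237636l1` consists of primes and multiplies to `|Δ(E₀)|`, IN THE KERNEL: a prime dividing `Δ_min` is one of `[2, 3, 7, 23, 41]`. [cite: Cremona2006, Table 1 (Cremona label 237636l1)] -/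
theorem krausList_237636l1 : (∀ qe ∈ ([(2, 4), (3, 6), (7, 3), (23, 1), (41, 3)] : List (ℕ × ℕ)), qe.1.Prime) ∧
    (([(2, 4), (3, 6), (7, 3), (23, 1), (41, 3)] : List (ℕ × ℕ)).map fun qe => qe.1 ^ qe.2).prod = (6341924057616 : ℤ).natAbs :=
  ⟨by decide +kernel, by decide +kernel⟩

/-- **U₁ AT `237636l1` BY THE INERT-CARRIER (Shimura-curve) ROAD, TU|inert** — `MissingUpperBoundAt W 3` at `W = E` from rhp-p2 g10's instrument
p657297 (two carriers, Papikian–Rabinoff (DEG)) through the §0 door `leafRankOneUpper_three_of_twoCarriers_of_sqrtField` of part one.  PRINTED: `hGZK hmod hnf hJL hCO hHK`.  KERNEL: `Addv ∧ SubGss` at `3`;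
`7`, `41` split (nodal roots `2`, `16`); every prime of `Δ_min` enumerated (`krausList_237636l1`) for `hothers` and `hshape` (`c = 1` off `Δ_min`, Kodaira–Néron at the
multiplicative primes, Tate certificates at the additive primes `[2, 3]`); the congruences making `7`, `41` inert and the other `ℓ ∣ N` split in `ℚ(√-191)`; the twist
identity `Cd • E^{(-191)} = Wd`, `Cd = [1, 0, 0, 0]`, with `Wd` Kraus-minimal.  DISPLAYED: `hN`, `hr`, `Dt`/`hc` (`3 ∤ c(Dt)`), `hLt` (`L(E^{(-191)},1) ≠ 0`), `hqd`/`hvd`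
(`#Ш(Wd)_an = 4`).  NO ¬CM / S2 / Σ / L₀.  Per curve; U₁ (26022) stays OPEN class-wide; `BSDp W 3` follows by `bsdp_three_of_upper_of_shaAn_unit`; BSD is NOT proved by this.
[cite: JetchevSkinnerWan2017, §7.4.2 (p. 31)] [cite: PastenShimura2024, Prop. 6.13, Lemma 6.18] [cite: SilvermanAEC2009, VII.5 Prop. 5.1] [cite: Cremona2006, Table 1 (Cremona label 237636l1)] -/
theorem u1_at_237636l1
    (hGZK : rank_eq_analyticRank_of_analyticRank_le_one) (hmod : hasEntireLFunction_rat)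
    (hnf : exists_isNewformOf) (hJL : nonempty_shimuraParametrizationData)
    (hCO : PastenShimura2024_componentOrders)
    (hHK : shimuraCurve_heegnerPoint_grossZagier_kolyvagin)
    {W : WeierstrassCurve ℚ} [W.IsElliptic] [W.IsGloballyMinimal] (hWeq : W = (⟨0, 0, 0, -468513, 123432741⟩ : WeierstrassCurve ℚ))
    (hN : W.conductorNorm ℤ = 237636) [NeZero (W.conductorNorm ℤ)] (hr : W.analyticRank = 1)
    (Dt : ModularParametrizationData W (W.conductorNorm ℤ)) (hc : ¬ (3 : ℤ) ∣ Dt.c)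
    (hLt : (W.quadraticTwist (((-191 : ℤ) : ℚ))).entireLFunction 1 ≠ 0)
    {qd : ℚ} (hqd : haveI := isElliptic_sWd237636l1; shaAn (⟨0, 0, 0, -17091822753, -860063416464411⟩ : WeierstrassCurve ℚ) = (qd : ℂ))
    (hvd : padicValRat 3 qd ≤ 0) :
    MissingUpperBoundAt W 3 := by
  subst hWeq
  haveI := isElliptic_sWd237636l1; haveI := isGloballyMinimal_sWd237636l1
  have hI : integralModelInt (⟨0, 0, 0, -468513, 123432741⟩ : WeierstrassCurve ℚ) = (⟨0, 0, 0, -468513, 123432741⟩ : WeierstrassCurve ℤ) :=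
    integralModelInt_eq_of_map_eq _ (map_mk_int 0 0 0 (-468513) 123432741)
  have hGS := subGss_three_237636l1 (W := (⟨0, 0, 0, -468513, 123432741⟩ : WeierstrassCurve ℚ)) rfl
  have hs₁ : haveI : Fact (Nat.Prime 7) := ⟨by norm_num⟩; (⟨0, 0, 0, -468513, 123432741⟩ : WeierstrassCurve ℚ).HasSplitMultiplicativeReductionAtPrime 7 := by
    refine IntModel.hasSplitMultiplicativeReductionAtPrime_of_intModel_of_root hI 7 (by rw [Δ_eq_237636l1]; norm_num) (by rw [c₄_eq_237636l1]; norm_num) ⟨2, ?_⟩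
    simp only [WeierstrassCurve.c₄, WeierstrassCurve.b₂, WeierstrassCurve.b₄, WeierstrassCurve.b₆]; push_cast; decide
  have hs₂ : haveI : Fact (Nat.Prime 41) := ⟨by norm_num⟩; (⟨0, 0, 0, -468513, 123432741⟩ : WeierstrassCurve ℚ).HasSplitMultiplicativeReductionAtPrime 41 := by
    refine IntModel.hasSplitMultiplicativeReductionAtPrime_of_intModel_of_root hI 41 (by rw [Δ_eq_237636l1]; norm_num) (by rw [c₄_eq_237636l1]; norm_num) ⟨16, ?_⟩
    simp only [WeierstrassCurve.c₄, WeierstrassCurve.b₂, WeierstrassCurve.b₄, WeierstrassCurve.b₆]; push_cast; decide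
  haveI : Fact ((-191 : ℤ) < 0) := ⟨by norm_num⟩; haveI : Fact (Nat.Prime 7) := ⟨by norm_num⟩; haveI : Fact (Nat.Prime 41) := ⟨by norm_num⟩
  have hothers : ∀ (ℓ : ℕ) [Fact ℓ.Prime], ℓ ≠ 7 → ℓ ≠ 41 → (⟨0, 0, 0, -468513, 123432741⟩ : WeierstrassCurve ℚ).HasSplitMultiplicativeReductionAtPrime ℓ →
      ¬ 3 ∣ padicValInt ℓ (⟨0, 0, 0, -468513, 123432741⟩ : WeierstrassCurve ℚ).minimalDiscriminantInt := by
    intro ℓ hℓF hne₁ hne₂ hs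
    have hd := dvd_minimalDiscriminantInt_of_mult _ ℓ hs.hasMultiplicativeReductionAtPrime
    rw [IntModel.minimalDiscriminantInt_eq hI, Δ_eq_237636l1] at hd
    have hmem := mem_of_prime_dvd_of_prodPow_eq _ krausList_237636l1 hℓF.out hd
    simp only [List.map_cons, List.map_nil, List.mem_cons, List.not_mem_nil, or_false] at hmem
    rcases hmem with rfl | rfl | rfl | rfl | rfl
    · exact absurd hs.hasMultiplicativeReductionAtPrime (X9.PrintCert.not_hasMultiplicativeReductionAtPrime_of_dvd_of_dvd hI 2 (by rw [Δ_eq_237636l1]; norm_num) (by rw [c₄_eq_237636l1]; norm_num))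
    · exact absurd hs.hasMultiplicativeReductionAtPrime (X9.PrintCert.not_hasMultiplicativeReductionAtPrime_of_dvd_of_dvd hI 3 (by rw [Δ_eq_237636l1]; norm_num) (by rw [c₄_eq_237636l1]; norm_num))
    · exact absurd rfl hne₁
    · rw [IntModel.minimalDiscriminantInt_eq hI, Δ_eq_237636l1, IntModel.padicValInt_eq_of_dvd_of_not_dvd 23 (e := 1) (by norm_num) (by norm_num)]
      decide
    · exact absurd rfl hne₂
  have hshape : ∀ (q : ℕ) [Fact q.Prime], 3 ∣ ((⟨0, 0, 0, -468513, 123432741⟩ : WeierstrassCurve ℚ).baseChange ℚ_[q]).localTamagawaNumber ℤ_[q] →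
      (⟨0, 0, 0, -468513, 123432741⟩ : WeierstrassCurve ℚ).HasSplitMultiplicativeReductionAtPrime q := by
    intro q hqF h3
    by_cases hd : (q : ℤ) ∣ minimalDiscriminantInt (⟨0, 0, 0, -468513, 123432741⟩ : WeierstrassCurve ℚ)
    swap
    · exact absurd h3 (not_three_dvd_localTamagawaNumber_of_not_dvd _ q hd)
    rw [IntModel.minimalDiscriminantInt_eq hI, Δ_eq_237636l1] at hd
    have hmem := mem_of_prime_dvd_of_prodPow_eq _ krausList_237636l1 hqF.out hd
    simp only [List.map_cons, List.map_nil, List.mem_cons, List.not_mem_nil, or_false] at hmem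
    rcases hmem with rfl | rfl | rfl | rfl | rfl
    · have hc2 : ((⟨0, 0, 0, -468513, 123432741⟩ : WeierstrassCurve ℚ).baseChange ℚ_[2]).localTamagawaNumber ℤ_[2] = 1 := -- additive `2` (IV): Tate certificate
        (IntModelTam.localTamagawaNumber_padic_eq_of_intModel_of_tamX hI 2 (F := ⟨2, 1, 2, 1, 1, 1, 4, 0⟩) rfl (by decide +kernel)).trans (by decide)
      rw [hc2] at h3; exact absurd h3 (by decide)
    · have hc3 : ((⟨0, 0, 0, -468513, 123432741⟩ : WeierstrassCurve ℚ).baseChange ℚ_[3]).localTamagawaNumber ℤ_[3] = 4 := -- additive `3` (I0*): Tate certificate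
        (IntModelTam.localTamagawaNumber_padic_eq_of_intModel_of_tamZ hI 3 (F := ⟨3, 9, 0, 0, 0, 6, 0, 3⟩) rfl (by decide +kernel)).trans (by decide)
      rw [hc3] at h3; exact absurd h3 (by decide)
    · exact hs₁
    · exact (Koly.split_and_three_dvd_of_mult_of_three_dvd_localTamagawaNumber _ 23 (IntModel.hasMultiplicativeReductionAtPrime_of_intModel hI 23 (by rw [Δ_eq_237636l1]; norm_num) (by rw [c₄_eq_237636l1]; norm_num)) h3).1
    · exact hs₂
  have hjac : ∀ ℓ : ℕ, ℓ.Prime → ℓ ∣ (⟨0, 0, 0, -468513, 123432741⟩ : WeierstrassCurve ℚ).conductorNorm ℤ → ℓ ≠ 7 → ℓ ≠ 41 → ℓ ≠ 2 →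
      jacobiSym (-191) ℓ = 1 := by
    intro ℓ hℓ hℓN hne₁ hne₂ hℓ2
    rw [hN] at hℓN
    have hmem : ℓ ∈ Nat.primeFactors 237636 := Nat.mem_primeFactors.mpr ⟨hℓ, hℓN, by norm_num⟩
    rw [show Nat.primeFactors 237636 = {2, 3, 7, 23, 41} by decide +kernel] at hmem
    simp only [Finset.mem_insert, Finset.mem_singleton] at hmem
    rcases hmem with rfl | rfl | rfl | rfl | rfl
    · exact absurd rfl hℓ2
    · norm_num [jacobiSym.mod_left]
    · exact absurd rfl hne₁
    · norm_num [jacobiSym.mod_left]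
    · exact absurd rfl hne₂
  have hWd : (⟨1, (0 : ℚ), (0 : ℚ), (0 : ℚ)⟩ : VariableChange ℚ) • (⟨0, 0, 0, -468513, 123432741⟩ : WeierstrassCurve ℚ).quadraticTwist (((-191 : ℤ) : ℚ)) =
      (⟨0, 0, 0, -17091822753, -860063416464411⟩ : WeierstrassCurve ℚ) := by
    push_cast; ext <;> simp [WeierstrassCurve.variableChange_a₁, WeierstrassCurve.variableChange_a₂,
      WeierstrassCurve.variableChange_a₃, WeierstrassCurve.variableChange_a₄, WeierstrassCurve.variableChange_a₆,
      WeierstrassCurve.quadraticTwist, WeierstrassCurve.b₂, WeierstrassCurve.b₄, WeierstrassCurve.b₆] <;> norm_num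
  exact leafRankOneUpper_three_of_twoCarriers_of_sqrtField hGZK hmod hnf hJL hCO hHK _ hGS.1 hGS.2 hr rfl Dt hc
    (q₁ := 7) (q₂ := 41) (by decide) hs₁ hs₂ hothers (by decide) (by decide) hshape
    (-191) (by norm_num)
    (by rw [show (-191 : ℤ).natAbs = 191 by rfl, Nat.squarefree_iff_nodup_primeFactorsList (by norm_num)]; simp)
    (Or.inr ⟨by decide, by norm_num [jacobiSym.mod_left]⟩) (by norm_num) (by norm_num [jacobiSym.mod_left]) (by norm_num) hjac
    (fun _ _ ↦ by norm_num) hLt _ _ hWd hqd hvd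

end Summit.BirchSwinnertonDyer.BirchSwinnertonDyer.Theorems.RamifiedHeegnerPairTwistUnitInert

end
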